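import Literature.Geometry.Manifold.ShuffleColumns
import Literature.Geometry.Manifold.CubeFubini
import HarnessLib

/-!
# The shuffle Fubini identity

Topic `Literature/Geometry/Manifold`. The analytic core of the comparison of the de Rham (wedge)
product with the Alexander–Whitney cup product through the Eilenberg–Zilber shuffle product
(`…SingularHomology.ShuffleChains`, `…EilenbergZilberChains`): **the signed sum over the
`(p,q)`-shuffles `w` of the integrals over the cube `[0,1]ⁿ` (`n = p + q`) of
`t ↦ Ω(Φ_w t)(∂₀Φ_w, …, ∂_{n-1}Φ_w)` equals the integral of `Ω(x)(block frame)` over the product of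
cubes `[0,1]ᵖ × [0,1]^q`** (`shuffle_sum_setIntegral_eq`), for every continuous function `Ω` on
`ℝᵖ × ℝ^q` with values in alternating `n`-forms (and any Banach space of coefficients). Here
`Φ_w = (S_w, T_w)` are the monomial cube maps of the shuffle simplex `w`
(`…Manifold.ShuffleCubeMaps`): geometrically, the shuffle simplices triangulate `Δᵖ × Δ^q`, and in
the collapsed-cube coordinates of the tree's simplex integral the triangulation becomes the
recursive decomposition of `[0,1]ᵖ⁺¹ × [0,1]^{q+1} ∋ ((a,š),(b,š'))` into `{b ≤ a}` and `{a ≤ b}`,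
each rescaled to a product of cubes (`…Manifold.CubeFubini.setIntegral_unitSquare_split`).

The proof is the induction on `n` along the cone recursion of the shuffle chains
(`shuffle (n+1) (p+1) = o·R₀(shuffle n p) + (-1)^{p+1} o·U₀(shuffle n (p+1))`): the integrand
recursion `…ShuffleColumns.shuffleIntegrand_consR/U` transports `Ω` to `ΩR a Ω` / `ΩU a Ω` on the
smaller product, the induction hypothesis applies to the transported (continuous) forms, the
block-frame identities `…ShuffleBlockVectors.map_consR_succ/map_consU_succ` evaluate them on the
block frame (producing the Jacobian factor `a` and, for the up-step, the sign `(-1)^{p+1}` that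
cancels the shuffle sign), and the cube Fubini lemmas identify the two resulting integrals with the
two rescaled halves of `[0,1]ᵖ⁺¹ × [0,1]^{q+1}` (`setIntegral_cubeProd_succ_succ`; degenerate
one-branch versions `…_succ_zero`, `…_zero_succ` when a factor is a point).

Everything is proved; no named facts.

## References

* S. Eilenberg, S. Mac Lane, On the groups `H(Π,n)`. I, Ann. of Math. 58 (1953), §5. [folklore attribution]
* G. E. Bredon, *Topology and Geometry*, GTM 139 (1993), VI §4 (de Rham's theorem is multiplicative). [Bredon1993]
-/

noncomputable section

open Set MeasureTheory Function Literature.LinearAlgebra.Alternating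
open Literature.AlgebraicTopology.SingularHomology Literature.AlgebraicTopology.SingularHomology.ShuffleChains
  Literature.AlgebraicTopology.SingularHomology.TupleChain

namespace Literature.Geometry.Manifold

variable {F : Type*} [NormedAddCommGroup F] [NormedSpace ℝ F]

/-! ### The chain pairing `c ↦ Σ_w c(w) • J(w)` -/

section Pairing

variable {m : ℕ}

/-- The pairing of a tuple chain with a function on tuples: `⟨J, c⟩ = Σ_w c(w) • J(w)`. [folklore] -/
def chainPairing (J : (Fin (m + 1) → V) → F) (c : TupleChain V m) : F := c.sum fun w z ↦ (z : ℝ) • J w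

/-- The pairing with an elementary chain. [folklore] -/
theorem chainPairing_single (J : (Fin (m + 1) → V) → F) (w : Fin (m + 1) → V) (z : ℤ) :
    chainPairing J (Finsupp.single w z) = (z : ℝ) • J w := by
  simp [chainPairing, Finsupp.sum_single_index]

/-- The pairing with zero. [folklore] -/
theorem chainPairing_zero (J : (Fin (m + 1) → V) → F) : chainPairing J (0 : TupleChain V m) = 0 := by
  simp [chainPairing]

/-- The pairing is additive in the chain. [folklore] -/
theorem chainPairing_add (J : (Fin (m + 1) → V) → F) (c d : TupleChain V m) :
    chainPairing J (c + d) = chainPairing J c + chainPairing J d := by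
  unfold chainPairing
  rw [Finsupp.sum_add_index']
  · intro w; simp
  · intro w z z'; simp [add_smul]

/-- The pairing is homogeneous in the chain. [folklore] -/
theorem chainPairing_zsmul (J : (Fin (m + 1) → V) → F) (z : ℤ) (c : TupleChain V m) :
    chainPairing J (z • c) = (z : ℝ) • chainPairing J c := by
  unfold chainPairing
  rw [Finsupp.sum_smul_index']
  · simp only [Finsupp.sum, Finset.smul_sum, smul_eq_mul, Int.cast_mul, mul_smul]
  · intro w; simp

/-- **The pairing with a cone of a push-forward** re-indexes the function. [folklore] -/
theorem chainPairing_cone_push (J : (Fin (m + 2) → V) → F) (g : V → V) (c : TupleChain V m) :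
    chainPairing J (cone o (push g m c)) = chainPairing (fun v ↦ J (Fin.cons o (g ∘ v))) c := by
  unfold chainPairing
  simp only [TupleChain.cone, TupleChain.push, Finsupp.lmapDomain_apply]
  rw [Finsupp.sum_mapDomain_index (fun _ ↦ by simp) (fun _ _ _ ↦ by simp [add_smul]),
    Finsupp.sum_mapDomain_index (fun _ ↦ by simp) (fun _ _ _ ↦ by simp [add_smul])]

/-- The pairing depends only on the values of the function (pointwise congruence). [folklore] -/
theorem chainPairing_congr {J J' : (Fin (m + 1) → V) → F} (c : TupleChain V m) (h : ∀ w, J w = J' w) :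
    chainPairing J c = chainPairing J' c := by
  unfold chainPairing
  exact Finsupp.sum_congr fun w _ ↦ by rw [h w]

/-- **Interchanging the pairing with an integral over `[0,1]`** (finite sum). [folklore] -/
theorem chainPairing_setIntegral [CompleteSpace F] (c : TupleChain V m) (K : (Fin (m + 1) → V) → ℝ → F) (hK : ∀ w, Continuous (K w)) :
    chainPairing (fun w ↦ ∫ a in Icc (0 : ℝ) 1, K w a) c = ∫ a in Icc (0 : ℝ) 1, chainPairing (fun w ↦ K w a) c := by
  unfold chainPairing Finsupp.sum
  simp only []
  rw [MeasureTheory.integral_finsetSum]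
  · refine Finset.sum_congr rfl fun w _ ↦ ?_
    exact (MeasureTheory.integral_smul _ _).symm
  · intro w _
    exact ((hK w).continuousOn.integrableOn_compact isCompact_Icc).smul _

end Pairing

/-! ### Block Fubini lemmas on products of cubes -/

section BlockFubini

variable [CompleteSpace F]

omit [CompleteSpace F] in
/-- Fubini on a product of cubes for a continuous integrand. [folklore] -/
theorem setIntegral_cubeProd {p q : ℕ} (G : X p q → F) (hG : Continuous G) :
    ∫ x in Icc (0 : Fin p → ℝ) 1 ×ˢ Icc (0 : Fin q → ℝ) 1, G x =
      ∫ s in Icc (0 : Fin p → ℝ) 1, ∫ s' in Icc (0 : Fin q → ℝ) 1, G (s, s') := by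
  rw [Measure.volume_eq_prod, setIntegral_prod]
  exact hG.continuousOn.integrableOn_compact (isCompact_Icc.prod isCompact_Icc)

/-- `scaleFirst` on `ℝ⁰` is trivial. [folklore] -/
theorem scaleFirst_fin_zero (a : ℝ) (s : Fin 0 → ℝ) : scaleFirst a s = 0 := funext fun j ↦ j.elim0

/-- **Right-step, point factor**: `∫_{[0,1]ᵖ⁺¹ × [0,1]⁰} G = ∫_a ∫_{[0,1]ᵖ × [0,1]⁰} G ∘ hR a`. [folklore] -/
theorem setIntegral_cubeProd_succ_zero {p : ℕ} (G : X (p + 1) 0 → F) (hG : Continuous G) :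
    ∫ x in Icc (0 : Fin (p + 1) → ℝ) 1 ×ˢ Icc (0 : Fin 0 → ℝ) 1, G x =
      ∫ a in Icc (0 : ℝ) 1, ∫ y in Icc (0 : Fin p → ℝ) 1 ×ˢ Icc (0 : Fin 0 → ℝ) 1, G (hR p 0 a y) := by
  rw [setIntegral_cubeProd G hG]
  simp only [setIntegral_unitCube_zero]
  rw [setIntegral_unitCube_succ (fun s ↦ G (s, 0)) (hG.comp (continuous_id.prodMk continuous_const))]
  refine setIntegral_congr_fun measurableSet_Icc fun a _ ↦ ?_
  rw [setIntegral_cubeProd (fun y ↦ G (hR p 0 a y)) (hG.comp (continuous_hR p 0 a))]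
  simp only [setIntegral_unitCube_zero]
  refine setIntegral_congr_fun measurableSet_Icc fun s _ ↦ ?_
  simp only [hR, scaleFirst_fin_zero]

/-- **Up-step, point factor**: `∫_{[0,1]⁰ × [0,1]^{q+1}} G = ∫_a ∫_{[0,1]⁰ × [0,1]^q} G ∘ hU a`. [folklore] -/
theorem setIntegral_cubeProd_zero_succ {q : ℕ} (G : X 0 (q + 1) → F) (hG : Continuous G) :
    ∫ x in Icc (0 : Fin 0 → ℝ) 1 ×ˢ Icc (0 : Fin (q + 1) → ℝ) 1, G x =
      ∫ a in Icc (0 : ℝ) 1, ∫ y in Icc (0 : Fin 0 → ℝ) 1 ×ˢ Icc (0 : Fin q → ℝ) 1, G (hU 0 q a y) := by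
  rw [setIntegral_cubeProd G hG, setIntegral_unitCube_zero,
    setIntegral_unitCube_succ (fun s' ↦ G (0, s')) (hG.comp (continuous_const.prodMk continuous_id))]
  refine setIntegral_congr_fun measurableSet_Icc fun a _ ↦ ?_
  rw [setIntegral_cubeProd (fun y ↦ G (hU 0 q a y)) (hG.comp (continuous_hU 0 q a)), setIntegral_unitCube_zero]
  refine setIntegral_congr_fun measurableSet_Icc fun s' _ ↦ ?_
  simp only [hU, scaleFirst_fin_zero]

/-- Continuity of `(a, š) ↦ (a, š)`-type maps into a product, first factor. [folklore] -/
theorem continuous_consFst {p q : ℕ} : Continuous fun z : ℝ × ((Fin p → ℝ) × (Fin q → ℝ)) ↦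
    ((Fin.cons z.1 z.2.1 : Fin (p + 1) → ℝ), z.2.2) :=
  ((continuous_cons' p).comp (continuous_fst.prodMk (continuous_fst.comp continuous_snd))).prodMk
    (continuous_snd.comp continuous_snd)

/-- **The block scaled square**: for continuous `G` on `ℝᵖ⁺¹ × ℝ^{q+1}`,
`∫_{[0,1]ᵖ⁺¹×[0,1]^{q+1}} G = ∫_a ∫_{[0,1]ᵖ×[0,1]^{q+1}} a • G ∘ hR a + ∫_b ∫_{[0,1]ᵖ⁺¹×[0,1]^q} b • G ∘ hU b`. [folklore] -/
theorem setIntegral_cubeProd_succ_succ {p q : ℕ} (G : X (p + 1) (q + 1) → F) (hG : Continuous G) :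
    ∫ x in Icc (0 : Fin (p + 1) → ℝ) 1 ×ˢ Icc (0 : Fin (q + 1) → ℝ) 1, G x =
      (∫ a in Icc (0 : ℝ) 1, ∫ y in Icc (0 : Fin p → ℝ) 1 ×ˢ Icc (0 : Fin (q + 1) → ℝ) 1, a • G (hR p (q + 1) a y)) +
        ∫ b in Icc (0 : ℝ) 1, ∫ y in Icc (0 : Fin (p + 1) → ℝ) 1 ×ˢ Icc (0 : Fin q → ℝ) 1, b • G (hU (p + 1) q b y) := by
  -- the four-variable integrand and its partial integrals
  set G4 : ℝ → ℝ → (Fin p → ℝ) → (Fin q → ℝ) → F := fun a b š š' ↦ G (Fin.cons a š, Fin.cons b š') with hG4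
  have hG4c : Continuous fun z : ℝ × ℝ × (Fin p → ℝ) × (Fin q → ℝ) ↦ G4 z.1 z.2.1 z.2.2.1 z.2.2.2 := by
    simp only [hG4]
    refine hG.comp (Continuous.prodMk ?_ ?_)
    · exact (continuous_cons' p).comp (continuous_fst.prodMk (continuous_fst.comp (continuous_snd.comp continuous_snd)))
    · exact (continuous_cons' q).comp ((continuous_fst.comp continuous_snd).prodMk
        (continuous_snd.comp (continuous_snd.comp continuous_snd)))
  -- `K₁ a b š = ∫ š', G4 a b š š'` is continuous in `(a, b, š)`
  set K1 : ℝ → ℝ → (Fin p → ℝ) → F := fun a b š ↦ ∫ š' in Icc (0 : Fin q → ℝ) 1, G4 a b š š' with hK1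
  have hK1c : Continuous fun z : ℝ × ℝ × (Fin p → ℝ) ↦ K1 z.1 z.2.1 z.2.2 := by
    simp only [hK1]
    refine continuous_parametric_integral_of_continuous (f := fun (z : ℝ × ℝ × (Fin p → ℝ)) š' ↦ G4 z.1 z.2.1 z.2.2 š') ?_
      isCompact_Icc
    exact hG4c.comp ((continuous_fst.comp continuous_fst).prodMk ((continuous_fst.comp (continuous_snd.comp continuous_fst)).prodMk
      ((continuous_snd.comp (continuous_snd.comp continuous_fst)).prodMk continuous_snd)))
  -- `K₂ (a, b) = ∫ š, K₁ a b š` is continuous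
  set K2 : ℝ × ℝ → F := fun z ↦ ∫ š in Icc (0 : Fin p → ℝ) 1, K1 z.1 z.2 š with hK2
  have hK2c : Continuous K2 := by
    simp only [hK2]
    refine continuous_parametric_integral_of_continuous (f := fun (z : ℝ × ℝ) š ↦ K1 z.1 z.2 š) ?_ isCompact_Icc
    exact hK1c.comp ((continuous_fst.comp continuous_fst).prodMk ((continuous_snd.comp continuous_fst).prodMk continuous_snd))
  -- Step 1: LHS = ∫_a ∫_b K₂(a,b)
  have hLHS : ∫ x in Icc (0 : Fin (p + 1) → ℝ) 1 ×ˢ Icc (0 : Fin (q + 1) → ℝ) 1, G x =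
      ∫ a in Icc (0 : ℝ) 1, ∫ b in Icc (0 : ℝ) 1, K2 (a, b) := by
    rw [setIntegral_cubeProd G hG]
    have hin : Continuous fun s : Fin (p + 1) → ℝ ↦ ∫ s' in Icc (0 : Fin (q + 1) → ℝ) 1, G (s, s') :=
      continuous_parametric_integral_of_continuous (f := fun s s' ↦ G (s, s')) hG isCompact_Icc
    rw [setIntegral_unitCube_succ _ hin]
    refine setIntegral_congr_fun measurableSet_Icc fun a _ ↦ ?_
    -- inner: ∫_š ∫_{s'} G (cons a š, s') = ∫_š ∫_b ∫_š' G4 = ∫_š ∫_b K1 a b š ; then swap š ↔ b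
    have h1 : ∀ š : Fin p → ℝ, ∫ s' in Icc (0 : Fin (q + 1) → ℝ) 1, G (Fin.cons a š, s') =
        ∫ b in Icc (0 : ℝ) 1, K1 a b š := by
      intro š
      rw [setIntegral_unitCube_succ (fun s' ↦ G (Fin.cons a š, s')) (hG.comp (continuous_const.prodMk continuous_id))]
    simp_rw [h1]
    rw [setIntegral_setIntegral_swap_of_continuous (fun š b ↦ K1 a b š)
      (hK1c.comp (continuous_const.prodMk (continuous_snd.prodMk continuous_fst))) isCompact_Icc isCompact_Icc]
  rw [hLHS, setIntegral_unitSquare_split K2 hK2c]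
  congr 1
  · -- right-step half
    refine setIntegral_congr_fun measurableSet_Icc fun a _ ↦ ?_
    rw [MeasureTheory.integral_smul]
    congr 1
    -- ∫_σ K₂(a, aσ) = ∫_{y ∈ cube p × cube (q+1)} G (hR a y)
    rw [setIntegral_cubeProd (fun y ↦ G (hR p (q + 1) a y)) (hG.comp (continuous_hR p (q + 1) a))]
    have h2 : ∀ š : Fin p → ℝ, ∫ s' in Icc (0 : Fin (q + 1) → ℝ) 1, G (hR p (q + 1) a (š, s')) =
        ∫ σ in Icc (0 : ℝ) 1, K1 a (a * σ) š := by
      intro š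
      rw [setIntegral_unitCube_succ (fun s' ↦ G (hR p (q + 1) a (š, s')))
        ((hG.comp (continuous_hR p (q + 1) a)).comp (continuous_const.prodMk continuous_id))]
      refine setIntegral_congr_fun measurableSet_Icc fun σ _ ↦ ?_
      simp only [hK1, hG4, hR, scaleFirst_cons]
    simp_rw [h2]
    rw [setIntegral_setIntegral_swap_of_continuous (fun š σ ↦ K1 a (a * σ) š)
      (hK1c.comp (continuous_const.prodMk (((continuous_const.mul continuous_snd)).prodMk continuous_fst)))
      isCompact_Icc isCompact_Icc]
  · -- up-step half
    refine setIntegral_congr_fun measurableSet_Icc fun b _ ↦ ?_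
    rw [MeasureTheory.integral_smul]
    congr 1
    rw [setIntegral_cubeProd (fun y ↦ G (hU (p + 1) q b y)) (hG.comp (continuous_hU (p + 1) q b)),
      setIntegral_unitCube_succ (fun s ↦ ∫ s' in Icc (0 : Fin q → ℝ) 1, G (hU (p + 1) q b (s, s'))) ?_]
    · refine setIntegral_congr_fun measurableSet_Icc fun σ _ ↦ ?_
      simp only [hK2, hK1, hG4, hU, scaleFirst_cons]
    · exact continuous_parametric_integral_of_continuous
        (f := fun s s' ↦ G (hU (p + 1) q b (s, s'))) ((hG.comp (continuous_hU (p + 1) q b))) isCompact_Icc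

end BlockFubini

/-! ### The shuffle Fubini identity -/

section Main

variable [CompleteSpace F]

/-- The shuffle side: `Σ_w shuffle(w) • ∫_{[0,1]ⁿ} Ω(Φ_w t)(∂Φ_w) dt`. [folklore] -/
def shuffleSide (n p q : ℕ) (Ω : X p q → X p q [⋀^Fin n]→L[ℝ] F) : F :=
  chainPairing (fun w ↦ ∫ t in Icc (0 : Fin n → ℝ) 1, shuffleIntegrand p q Ω w t) (shuffle n p)

/-- The shuffle side after an initial right-step: an integral of shuffle sides of transported forms. [folklore] -/
theorem chainPairing_consR {n p q : ℕ} (Ω : X (p + 1) q → X (p + 1) q [⋀^Fin (n + 1)]→L[ℝ] F) (hΩ : Continuous Ω)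
    (c : TupleChain V n) :
    chainPairing (fun w ↦ ∫ t in Icc (0 : Fin (n + 1) → ℝ) 1, shuffleIntegrand (p + 1) q Ω w t) (cone o (push (faceR 0) n c)) =
      ∫ a in Icc (0 : ℝ) 1, chainPairing (fun v ↦ ∫ t' in Icc (0 : Fin n → ℝ) 1, shuffleIntegrand p q (OmegaR p q a Ω) v t') c := by
  rw [chainPairing_cone_push]
  have h1 : ∀ v : Fin (n + 1) → V, ∫ t in Icc (0 : Fin (n + 1) → ℝ) 1, shuffleIntegrand (p + 1) q Ω (Fin.cons o (faceR 0 ∘ v)) t =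
      ∫ a in Icc (0 : ℝ) 1, ∫ t' in Icc (0 : Fin n → ℝ) 1, shuffleIntegrand p q (OmegaR p q a Ω) v t' := by
    intro v
    rw [setIntegral_unitCube_succ _ (continuous_shuffleIntegrand (p + 1) q hΩ _)]
    simp only [shuffleIntegrand_consR]
  rw [chainPairing_congr c h1, chainPairing_setIntegral]
  intro v
  have : (fun a ↦ ∫ t' in Icc (0 : Fin n → ℝ) 1, shuffleIntegrand p q (OmegaR p q a Ω) v t') =
      fun a ↦ ∫ t' in Icc (0 : Fin n → ℝ) 1, shuffleIntegrand (p + 1) q Ω (Fin.cons o (faceR 0 ∘ v)) (Fin.cons a t') := by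
    funext a; simp only [shuffleIntegrand_consR]
  rw [this]
  exact continuous_parametric_integral_of_continuous
    (f := fun a t' ↦ shuffleIntegrand (p + 1) q Ω (Fin.cons o (faceR 0 ∘ v)) (Fin.cons a t'))
    ((continuous_shuffleIntegrand (p + 1) q hΩ _).comp (continuous_cons' n)) isCompact_Icc

/-- The shuffle side after an initial up-step. [folklore] -/
theorem chainPairing_consU {n p q : ℕ} (Ω : X p (q + 1) → X p (q + 1) [⋀^Fin (n + 1)]→L[ℝ] F) (hΩ : Continuous Ω)
    (c : TupleChain V n) :
    chainPairing (fun w ↦ ∫ t in Icc (0 : Fin (n + 1) → ℝ) 1, shuffleIntegrand p (q + 1) Ω w t) (cone o (push (faceU 0) n c)) =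
      ∫ a in Icc (0 : ℝ) 1, chainPairing (fun v ↦ ∫ t' in Icc (0 : Fin n → ℝ) 1, shuffleIntegrand p q (OmegaU p q a Ω) v t') c := by
  rw [chainPairing_cone_push]
  have h1 : ∀ v : Fin (n + 1) → V, ∫ t in Icc (0 : Fin (n + 1) → ℝ) 1, shuffleIntegrand p (q + 1) Ω (Fin.cons o (faceU 0 ∘ v)) t =
      ∫ a in Icc (0 : ℝ) 1, ∫ t' in Icc (0 : Fin n → ℝ) 1, shuffleIntegrand p q (OmegaU p q a Ω) v t' := by
    intro v
    rw [setIntegral_unitCube_succ _ (continuous_shuffleIntegrand p (q + 1) hΩ _)]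
    simp only [shuffleIntegrand_consU]
  rw [chainPairing_congr c h1, chainPairing_setIntegral]
  intro v
  have : (fun a ↦ ∫ t' in Icc (0 : Fin n → ℝ) 1, shuffleIntegrand p q (OmegaU p q a Ω) v t') =
      fun a ↦ ∫ t' in Icc (0 : Fin n → ℝ) 1, shuffleIntegrand p (q + 1) Ω (Fin.cons o (faceU 0 ∘ v)) (Fin.cons a t') := by
    funext a; simp only [shuffleIntegrand_consU]
  rw [this]
  exact continuous_parametric_integral_of_continuous
    (f := fun a t' ↦ shuffleIntegrand p (q + 1) Ω (Fin.cons o (faceU 0 ∘ v)) (Fin.cons a t'))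
    ((continuous_shuffleIntegrand p (q + 1) hΩ _).comp (continuous_cons' n)) isCompact_Icc

/-- **The shuffle Fubini identity.** For every continuous `Ω : ℝᵖ × ℝ^q → Altⁿ(ℝᵖ × ℝ^q; F)`,
`p + q = n`:
`Σ_w shuffle(w) ∫_{[0,1]ⁿ} Ω(Φ_w t)(∂₀Φ_w,…,∂_{n-1}Φ_w) dt = ∫_{[0,1]ᵖ×[0,1]^q} Ω(x)(block frame) dx`.
[cite: Bredon1993, VI §4 (multiplicativity of the de Rham map; shuffle triangulation of Δᵖ×Δ^q)] -/
theorem shuffleSide_eq : ∀ (n p q : ℕ) (h : p + q = n) (Ω : X p q → X p q [⋀^Fin n]→L[ℝ] F), Continuous Ω →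
    shuffleSide n p q Ω = ∫ x in Icc (0 : Fin p → ℝ) 1 ×ˢ Icc (0 : Fin q → ℝ) 1, Ω x (stdBlock p q n h)
  | 0, p, q, h, Ω, hΩ => by
    obtain rfl : p = 0 := by omega
    obtain rfl : q = 0 := by omega
    rw [shuffleSide, shuffle_zero_zero, chainPairing_single, Int.cast_one, one_smul, setIntegral_unitCube_zero,
      setIntegral_cubeProd (fun x ↦ Ω x (stdBlock 0 0 0 h)) (hΩ.eval continuous_const), setIntegral_unitCube_zero,
      setIntegral_unitCube_zero,
      shuffleIntegrand]
    have hpt : Phi 0 0 (fun _ : Fin 1 ↦ o) 0 = ((0 : Fin 0 → ℝ), (0 : Fin 0 → ℝ)) :=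
      Prod.ext (funext fun j ↦ j.elim0) (funext fun j ↦ j.elim0)
    rw [hpt]
    congr 1
    funext i
    exact i.elim0
  | n + 1, 0, q, h, Ω, hΩ => by
    obtain rfl : q = n + 1 := by omega
    rw [shuffleSide, shuffle_succ_zero, chainPairing_consU Ω hΩ,
      setIntegral_cubeProd_zero_succ (fun x ↦ Ω x (stdBlock 0 (n + 1) (n + 1) h)) (hΩ.eval continuous_const)]
    refine setIntegral_congr_fun measurableSet_Icc fun a _ ↦ ?_
    have IH := shuffleSide_eq n 0 n (by omega) (OmegaU 0 n a Ω) (continuous_OmegaU 0 n a hΩ)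
    rw [shuffleSide] at IH
    rw [IH]
    refine setIntegral_congr_fun (measurableSet_Icc.prod measurableSet_Icc) fun y _ ↦ ?_
    rw [OmegaU_apply, map_consU_zero]
  | n + 1, p + 1, q, h, Ω, hΩ => by
    have h1 : p + q = n := by omega
    rw [shuffleSide, shuffle_succ_succ, chainPairing_add, chainPairing_zsmul, chainPairing_consR Ω hΩ]
    -- the right-step branch
    have hR : ∫ a in Icc (0 : ℝ) 1, chainPairing (fun v ↦ ∫ t' in Icc (0 : Fin n → ℝ) 1,
        shuffleIntegrand p q (OmegaR p q a Ω) v t') (shuffle n p) =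
        ∫ a in Icc (0 : ℝ) 1, ∫ y in Icc (0 : Fin p → ℝ) 1 ×ˢ Icc (0 : Fin q → ℝ) 1,
          Ω (hR p q a y) (Fin.cons (cR p q y.2) fun i ↦ LRL p q a (stdBlock p q n h1 i)) := by
      refine setIntegral_congr_fun measurableSet_Icc fun a _ ↦ ?_
      have IH := shuffleSide_eq n p q h1 (OmegaR p q a Ω) (continuous_OmegaR p q a hΩ)
      rw [shuffleSide] at IH
      rw [IH]
      refine setIntegral_congr_fun (measurableSet_Icc.prod measurableSet_Icc) fun y _ ↦ ?_
      rw [OmegaR_apply]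
    rw [hR]
    rcases q with _ | q'
    · -- `q = 0`: no up-step branch, no Jacobian factor
      obtain rfl : p = n := by omega
      rw [shuffle_eq_zero_of_lt (Nat.lt_succ_self p), map_zero, map_zero, chainPairing_zero, smul_zero, add_zero,
        setIntegral_cubeProd_succ_zero (fun x ↦ Ω x (stdBlock (p + 1) 0 (p + 1) h)) (hΩ.eval continuous_const)]
      refine setIntegral_congr_fun measurableSet_Icc fun a _ ↦ ?_
      refine setIntegral_congr_fun (measurableSet_Icc.prod measurableSet_Icc) fun y _ ↦ ?_
      rw [map_consR_zero]
    · -- `q = q' + 1`: both branches, Jacobian factor `a`, and the sign `(-1)^(p+1)` cancels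
      have h2 : p + 1 + q' = n := by omega
      rw [chainPairing_consU Ω hΩ, setIntegral_cubeProd_succ_succ (fun x ↦ Ω x (stdBlock (p + 1) (q' + 1) (n + 1) h)) (hΩ.eval continuous_const)]
      congr 1
      · refine setIntegral_congr_fun measurableSet_Icc fun a _ ↦ ?_
        refine setIntegral_congr_fun (measurableSet_Icc.prod measurableSet_Icc) fun y _ ↦ ?_
        rw [map_consR_succ]
      · rw [← MeasureTheory.integral_smul]
        refine setIntegral_congr_fun measurableSet_Icc fun a _ ↦ ?_
        have IH := shuffleSide_eq n (p + 1) q' h2 (OmegaU (p + 1) q' a Ω) (continuous_OmegaU (p + 1) q' a hΩ)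
        rw [shuffleSide] at IH
        rw [IH, ← MeasureTheory.integral_smul]
        refine setIntegral_congr_fun (measurableSet_Icc.prod measurableSet_Icc) fun y _ ↦ ?_
        rw [OmegaU_apply, map_consU_succ h2 h, smul_smul, Int.cast_pow, Int.cast_neg, Int.cast_one, ← mul_assoc,
          ← mul_pow, neg_mul_neg, one_mul, one_pow, one_mul]

/-- **The shuffle Fubini identity**, `Finsupp.sum` form with real coefficients:
`(shuffle n p).sum (w z ↦ z • ∫_{[0,1]ⁿ} Ω(Φ_w)(∂Φ_w)) = ∫_{[0,1]ᵖ×[0,1]^q} Ω(x)(stdBlock)`. [cite: Bredon1993, VI §4] -/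
theorem shuffle_sum_setIntegral_eq {n p q : ℕ} (h : p + q = n) (Ω : X p q → X p q [⋀^Fin n]→L[ℝ] F) (hΩ : Continuous Ω) :
    ((shuffle n p).sum fun w z ↦ (z : ℝ) • ∫ t in Icc (0 : Fin n → ℝ) 1, shuffleIntegrand p q Ω w t) =
      ∫ x in Icc (0 : Fin p → ℝ) 1 ×ˢ Icc (0 : Fin q → ℝ) 1, Ω x (stdBlock p q n h) :=
  shuffleSide_eq n p q h Ω hΩ

end Main

end Literature.Geometry.Manifold
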